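import Literature.NumberTheory.Rogawski1990.ExplicitFactorKappaAlmostEverywhereOne      -- ★ p828514 (N3): `finKappaAt_eq_one_of_integral_nonsplit`, FILE A `…TauWeyl`, `…KappaEigenvector`
import Literature.NumberTheory.Rogawski1990.FinExplicitTransferFactorNondegenerate      -- ★ N2f: `finHeckeValue_ne_zero_of_isUnit`, `trace_finEigenlineProjector_of_isLocalNormPair`
import Literature.NumberTheory.Rogawski1990.ExplicitFactorRationalLocalisation          -- ★ p827972: `finCharpolyTwo_rationalComponent`, `finGammaTwo_rationalComponent`
import HarnessLib

/-!
# Rogawski's explicit finite factor at a (G,H)-REGULAR (possibly `G`-SINGULAR) pair: `Δ‴_v(γ_H, γ) ≠ 0`, `κ‴_v(γ_H, γ) = ±1`, and `= +1`, `Δ‴_v = 1`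
# for almost all `v` — the `G`-regularity hypothesis of ★ N2f ∕ N3 weakened to `χ_g(u) ≠ 0` (Rogawski 1990, §14.6 p. 242; §4.9 p. 55; §8.2 p. 117)

Topic `NumberTheory/Rogawski1990`; namespace `Literature.NumberTheory.Rogawski1990`; **THEOREMS ONLY** (no definition, no named fact, no instance,
no notation, no `sorry`); no ★ file is edited — these are `_of_isUnit` ∕ `_of_eval_ne_zero` VARIANTS placed next to ★ `FinExplicitTransferFactorNondegenerate`
(N2f, B-p12 lineage), ★ `ExplicitFactorAlmostEverywhereTrivialTauWeyl` (FILE A) and ★ `ExplicitFactorKappaAlmostEverywhereOne` (N3, F0P3a-p01 (g7)), whose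
statements bind `IsLocalGRegular` ∕ `IsGRegular γ_H` but whose proofs consume it ONLY as «`χ_g(u)` is a unit of `E_v = ∏_{w∣v} L_w`» resp. «`χ_g(u) ≠ 0`
in `L`» (`g = γ_H.1`, `u = (γ_H.2)₀₀`).  Cell `pub/hodgecm-mathlib`, ENGINE T1 (crux H413 = `stmt-HodgeConjecture-24833`), #88 side: item **(P-β)** of
F0P3a-p05 (g9)'s `SIZING-S1prime` §5 («`Δ‴_v(γ_H, γ₀) ≠ 0` and `κ‴_v(γ_H, γ₀) = ±1` at the singular pair, `= +1` for almost all `v`» — the D-G4 DATA facts of the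
(κ-loc)∕(κ-sign) rows of the letter S1′ `stub_tamagawaSingularMembers_exist`), seat F0P3a-p08 (g10).  At S1′'s partner `γ_H = (e₁•1₂, e₂)` of a split-singular
rational `γ₀` (charpoly `(X − e₁)²(X − e₂)`, NOT separable ⇒ `¬ IsGRegular`) one has `χ_g(u) = χ_{e₁•1}(e₂) = (e₂ − e₁)² ≠ 0`, so every statement below applies
there; nothing here closes a stub today — a banked, count-neutral brick toward floor 1's (κ-loc)∕(κ-sign).  HC_CM is proved only modulo the printed citations
until rung 0 closes.

* §1 LOCAL, any finite `v`, hypothesis `hu : IsUnit (χ_g(u))` in `E_v`: `isUnit_finTauArg_of_isUnit`, `finTau_ne_zero_of_isUnit`, `finWeylRatio_ne_zero_of_isUnit`,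
  `finEigenlineProjector_ne_zero_of_isUnit`, **`finKappaAt_ne_zero_of_isUnit`**, **`finKappaAt_eq_one_or_eq_neg_one_of_isUnit`** («`κ(γ, ψ_v(iγ)) = ±1`»),
  **`finExplicitDelta_ne_zero_of_isUnit`** (`Δ‴_v(γ_H, γ′) = τ_v · D_v · κ_v ≠ 0` on a matching pair) — proofs = the ★ N2f proofs with `hu` for `hreg`.
* §2 RATIONAL `γ_H ∈ H(L⁺)` with `hχ : χ_g(u) ≠ 0` in `L`: **`isUnit_eval_finCharpolyTwo_rationalComponent_of_eval_ne_zero`** (`χ_g(u) ⊗ 1` is a unit of every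
  `E_v`, ★ `finCharpolyTwo_rationalComponent`), hence at every finite `v` and every local `γ′` matching `(γ_H)_v`:
  **`finExplicitDelta_rationalComponent_ne_zero_of_eval_ne_zero`**, **`finKappaAt_rationalComponent_eq_one_or_eq_neg_one_of_eval_ne_zero`**.
* §3 ALMOST ALL `v` (rational `γ_H` with `hχ`, adelic `γ̄` matching at every finite place): **`eventually_finTau_rationalComponent_eq_one_of_eval_ne_zero`**,
  **`eventually_finWeylRatio_rationalComponent_eq_one_of_eval_ne_zero`**, **`eventually_finKappaAt_rationalComponent_eq_one_of_eval_ne_zero`** («`+1` for almost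
  all `v`», ★ N3's 60-line packaging with `hχ` for `hreg`), and the product **`eventually_finExplicitDelta_rationalComponent_toLocal_eq_one_of_eval_ne_zero`**
  (`Δ‴_v((γ_H)_v, γ̄_v) = 1` for almost all `v`, ADELIC `γ̄`; the rational-pair form with `hanis` via the Hilbert-symbol road is (P-α)'s ★
  `eventually_finExplicitDelta_rationalComponent_eq_one_of_eval_ne_zero`, F0P3a-p05 (g9) — different statement, hence the `_toLocal_` name here).
Print: «`κ(γ, ψ_v(i(γ)))` is equal to `±1` and it is `+1` for almost all `v`» [§14.6 p. 242]; «`Δ_{G∕H}(γ₀)`» at the singular `γ₀ ∈ M` [Prop. 8.2.1 p. 117].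

## References
* [Rogawski1990] J. D. Rogawski, *Automorphic Representations of Unitary Groups in Three Variables*, Ann. of Math. Stud. 123 (1990): §4.3 pp. 43–44, §4.9
  p. 55, §8.2 Prop. 8.2.1 p. 117, §14.6 p. 242.
* [LanglandsShelstad1987] R. P. Langlands, D. Shelstad, *On the definition of transfer factors*, Math. Ann. 278 (1987): §1–§2.
* [Kottwitz1986] R. E. Kottwitz, *Stable trace formula: elliptic singular terms*, Math. Ann. 275 (1986): §7.
-/

set_option autoImplicit false

noncomputable section

open NumberField IsDedekindDomain Filter Matrix Polynomial
open Literature.NumberTheory.GaloisRepresentations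
open scoped MatrixGroups

namespace Literature.NumberTheory.Rogawski1990

open Literature.NumberTheory.Automorphic

/-! ## §1 Local: `χ_g(u)` a unit of `E_v` ⇒ `τ_v ≠ 0`, `D_v ≠ 0`, `P_v ≠ 0`, `κ_v = ±1`, `Δ‴_v ≠ 0` -/

section Place

variable (L : Type) [Field L] [NumberField L] [IsCMField L] (v : HeightOneSpectrum (𝓞 ↥(maximalRealSubfield L)))
  (H' : Matrix (Fin 3) (Fin 3) L)
  (a : (UnitaryGroup.cmDatum L 2 (Matrix.of fun i j : Fin 2 => if i.val + j.val + 1 = 2 then (1 : L) else 0)).Local v ×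
      (UnitaryGroup.cmDatum L 1 (Matrix.of fun i j : Fin 1 => if i.val + j.val + 1 = 1 then (1 : L) else 0)).Local v)
  (b : (UnitaryGroup.cmDatum L 3 H').Local v)

/-- **`τ_v`'s argument `−χ_g(u)·det g⁻¹` is a unit** when `χ_g(u)` is (★ `isUnit_finTauArg_of_isLocalGRegular` with its one input swapped).
[cite: Rogawski1990, §4.9 p. 55] -/
theorem isUnit_finTauArg_of_isUnit (hu : IsUnit ((finCharpolyTwo L v a).eval (finGammaTwo L v a))) : IsUnit (finTauArg L v a) := by
  unfold finTauArg
  exact (hu.neg).mul (Matrix.isUnits_det_units _)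

/-- **`τ_v(γ_H) ≠ 0`** when `χ_g(u)` is a unit of `E_v`. [cite: Rogawski1990, §4.9 p. 55] -/
theorem finTau_ne_zero_of_isUnit (μ : HeckeCharacter L) (hu : IsUnit ((finCharpolyTwo L v a).eval (finGammaTwo L v a))) :
    finTau L v a μ ≠ 0 :=
  mul_ne_zero (finHeckeValue_ne_zero_of_isUnit L v μ (isUnit_finGammaTwo L v a))
    (inv_ne_zero (finHeckeValue_ne_zero_of_isUnit L v μ (isUnit_finTauArg_of_isUnit L v a hu)))

/-- **`D_{G∕H,v}(γ_H) ≠ 0`** when `χ_g(u)` is a unit of `E_v` (`‖χ_g(u)_w‖_w > 0` at every `w ∣ v`). [cite: Rogawski1990, §4.9 p. 55] -/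
theorem finWeylRatio_ne_zero_of_isUnit (hu : IsUnit ((finCharpolyTwo L v a).eval (finGammaTwo L v a))) : finWeylRatio L v a ≠ 0 := by
  unfold finWeylRatio
  rw [Real.sqrt_ne_zero']
  exact Finset.prod_pos fun w _ => norm_pos_iff.2 ((Pi.isUnit_iff.1 hu w).ne_zero)

/-- **`P_v ≠ 0` on a matching pair** when `χ_g(u)` is a unit (its trace IS `χ_g(u)`, ★ `trace_finEigenlineProjector_of_isLocalNormPair`, and `E_v ≠ 0`).
[cite: Rogawski1990, §4.9 p. 55] -/
theorem finEigenlineProjector_ne_zero_of_isUnit (hp : IsLocalNormPair L H' v a b) (hu : IsUnit ((finCharpolyTwo L v a).eval (finGammaTwo L v a))) :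
    finEigenlineProjector L v H' a b ≠ 0 := by
  haveI : Nontrivial (UnitaryGroup.LocalRing L v) := by
    obtain ⟨w⟩ := (inferInstance : Nonempty (UnitaryGroup.PlacesOver L v))
    exact ⟨⟨0, 1, fun h => zero_ne_one (congrFun h w)⟩⟩
  intro h0
  have ht := trace_finEigenlineProjector_of_isLocalNormPair L v H' a b hp
  rw [h0, Matrix.trace_zero] at ht
  exact hu.ne_zero ht.symm

open scoped Classical in
/-- **`κ_v(γ_H, γ′) ≠ 0` on a matching pair** when `χ_g(u)` is a unit. [cite: Rogawski1990, §14.6 p. 242; §4.3 p. 43] -/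
theorem finKappaAt_ne_zero_of_isUnit (hp : IsLocalNormPair L H' v a b) (hu : IsUnit ((finCharpolyTwo L v a).eval (finGammaTwo L v a))) :
    finKappaAt L v H' a b ≠ 0 := by
  have hP := finEigenlineProjector_ne_zero_of_isUnit L v H' a b hp hu
  unfold finKappaAt
  rw [if_neg hP]
  split_ifs <;> decide

open scoped Classical in
/-- **«`κ(γ, ψ_v(i(γ)))` is equal to `±1`»**: on a matching pair with `χ_g(u)` a unit, `κ_v(γ_H, γ′) = 1 ∨ κ_v(γ_H, γ′) = −1`. [cite: Rogawski1990, §14.6 p. 242] -/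
theorem finKappaAt_eq_one_or_eq_neg_one_of_isUnit (hp : IsLocalNormPair L H' v a b)
    (hu : IsUnit ((finCharpolyTwo L v a).eval (finGammaTwo L v a))) :
    finKappaAt L v H' a b = 1 ∨ finKappaAt L v H' a b = -1 := by
  have hP := finEigenlineProjector_ne_zero_of_isUnit L v H' a b hp hu
  unfold finKappaAt
  rw [if_neg hP]
  split_ifs <;> decide

/-- **`Δ‴_v(γ_H, γ′) ≠ 0` on a matching pair** when `χ_g(u)` is a unit of `E_v`: `Δ‴_v = τ_v · D_v · κ_v` (★ `finExplicitDelta_of_isLocalNormPair`) with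
three non-zero factors. [cite: Rogawski1990, §4.9 p. 55; §14.6 p. 242] [cite: LanglandsShelstad1987, §1] -/
theorem finExplicitDelta_ne_zero_of_isUnit (μ : HeckeCharacter L) (hp : IsLocalNormPair L H' v a b)
    (hu : IsUnit ((finCharpolyTwo L v a).eval (finGammaTwo L v a))) : finExplicitDelta L v H' a μ b ≠ 0 := by
  rw [finExplicitDelta_of_isLocalNormPair L v H' a μ hp]
  refine mul_ne_zero (mul_ne_zero (finTau_ne_zero_of_isUnit L v a μ hu)
    (Complex.ofReal_ne_zero.2 (finWeylRatio_ne_zero_of_isUnit L v a hu))) ?_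
  rw [Int.cast_ne_zero]
  exact finKappaAt_ne_zero_of_isUnit L v H' a b hp hu

end Place

/-! ## §2 Rational `γ_H` with `χ_g(u) ≠ 0`: every finite place -/

section Rational

variable (L : Type) [Field L] [NumberField L] [IsCMField L] (H' : Matrix (Fin 3) (Fin 3) L)
  (γH : (UnitaryGroup.cmDatum L 2 (Matrix.of fun i j : Fin 2 => if i.val + j.val + 1 = 2 then (1 : L) else 0)).Rational ×
    (UnitaryGroup.cmDatum L 1 (Matrix.of fun i j : Fin 1 => if i.val + j.val + 1 = 1 then (1 : L) else 0)).Rational)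

/-- **(G,H)-regularity localised**: if `χ_g(u) ≠ 0` in `L` then `χ_g(u) ⊗ 1 = χ_{g_v}((γ₂)_v)` is a unit of `E_v = ∏_{w∣v} L_w` at every finite `v` (★
`finCharpolyTwo_rationalComponent`, ★ `finGammaTwo_rationalComponent`; a field element maps to a unit). [cite: Rogawski1990, §4.9 p. 55; §8.2 p. 117] -/
theorem isUnit_eval_finCharpolyTwo_rationalComponent_of_eval_ne_zero
    (hχ : ((γH.1.val.val : Matrix (Fin 2) (Fin 2) L).charpoly).eval ((γH.2.val.val : Matrix (Fin 1) (Fin 1) L) 0 0) ≠ 0)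
    (v : HeightOneSpectrum (𝓞 ↥(maximalRealSubfield L))) :
    IsUnit ((finCharpolyTwo L v (rationalComponent L γH v)).eval (finGammaTwo L v (rationalComponent L γH v))) := by
  rw [finCharpolyTwo_rationalComponent, finGammaTwo_rationalComponent, Polynomial.eval_map, Polynomial.eval₂_hom]
  exact (isUnit_iff_ne_zero.2 hχ).map _

/-- **`Δ‴_v(γ_H, γ′) ≠ 0` AT A (G,H)-REGULAR RATIONAL `γ_H`** (possibly `G`-singular, e.g. S1′'s partner `(e₁•1₂, e₂)`), for every finite `v` and every
local `γ′ ∈ U(H′)(L⁺_v)` matching `(γ_H)_v`. [cite: Rogawski1990, §8.2 Prop. 8.2.1 p. 117; §4.9 p. 55] -/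
theorem finExplicitDelta_rationalComponent_ne_zero_of_eval_ne_zero (μ : HeckeCharacter L)
    (hχ : ((γH.1.val.val : Matrix (Fin 2) (Fin 2) L).charpoly).eval ((γH.2.val.val : Matrix (Fin 1) (Fin 1) L) 0 0) ≠ 0)
    (v : HeightOneSpectrum (𝓞 ↥(maximalRealSubfield L))) (b : (UnitaryGroup.cmDatum L 3 H').Local v)
    (hp : IsLocalNormPair L H' v (rationalComponent L γH v) b) :
    finExplicitDelta L v H' (rationalComponent L γH v) μ b ≠ 0 :=
  finExplicitDelta_ne_zero_of_isUnit L v H' _ b μ hp (isUnit_eval_finCharpolyTwo_rationalComponent_of_eval_ne_zero L γH hχ v)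

/-- **`κ‴_v(γ_H, γ′) = ±1` AT A (G,H)-REGULAR RATIONAL `γ_H`**, every finite `v`, every local `γ′` matching `(γ_H)_v`. [cite: Rogawski1990, §14.6 p. 242] -/
theorem finKappaAt_rationalComponent_eq_one_or_eq_neg_one_of_eval_ne_zero
    (hχ : ((γH.1.val.val : Matrix (Fin 2) (Fin 2) L).charpoly).eval ((γH.2.val.val : Matrix (Fin 1) (Fin 1) L) 0 0) ≠ 0)
    (v : HeightOneSpectrum (𝓞 ↥(maximalRealSubfield L))) (b : (UnitaryGroup.cmDatum L 3 H').Local v)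
    (hp : IsLocalNormPair L H' v (rationalComponent L γH v) b) :
    finKappaAt L v H' (rationalComponent L γH v) b = 1 ∨ finKappaAt L v H' (rationalComponent L γH v) b = -1 :=
  finKappaAt_eq_one_or_eq_neg_one_of_isUnit L v H' _ b hp (isUnit_eval_finCharpolyTwo_rationalComponent_of_eval_ne_zero L γH hχ v)

/-! ## §3 Rational `γ_H` with `χ_g(u) ≠ 0`, adelic `γ̄`: almost all places -/

/-- **`τ_v((γ_H)_v) = 1` FOR ALMOST ALL `v`** under `χ_g(u) ≠ 0` (★ FILE A `eventually_finTau_rationalComponent_eq_one` with `hχ` for `hreg`: the two Hecke values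
are semi-local components of `μ` at the GLOBAL units `u`, `−χ_g(u)∕det g`). [cite: Rogawski1990, §4.9 p. 55; §14.6 p. 242] -/
theorem eventually_finTau_rationalComponent_eq_one_of_eval_ne_zero (μ : HeckeCharacter L)
    (hχ : ((γH.1.val.val : Matrix (Fin 2) (Fin 2) L).charpoly).eval ((γH.2.val.val : Matrix (Fin 1) (Fin 1) L) 0 0) ≠ 0) :
    ∀ᶠ v : HeightOneSpectrum (𝓞 ↥(maximalRealSubfield L)) in cofinite, finTau L v (rationalComponent L γH v) μ = 1 := by
  set u : L := (γH.2.val.val : Matrix (Fin 1) (Fin 1) L) 0 0 with hu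
  set t : L := -(((γH.1.val.val : Matrix (Fin 2) (Fin 2) L).charpoly).eval u) * (((γH.1.val⁻¹).val : Matrix (Fin 2) (Fin 2) L)).det with ht
  have hu0 : u ≠ 0 := gammaTwo_ne_zero L γH
  have ht0 : t ≠ 0 := mul_ne_zero (neg_ne_zero.2 hχ) (det_inv_fst_ne_zero L γH)
  filter_upwards [eventually_semilocalComponent_map_algebraMap_eq_one (↥(maximalRealSubfield L)) μ (Units.mk0 u hu0),
    eventually_semilocalComponent_map_algebraMap_eq_one (↥(maximalRealSubfield L)) μ (Units.mk0 t ht0)] with v hv1 hv2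
  rw [finTau_rationalComponent]
  have h1 := finHeckeValue_algebraMap_units L μ v (Units.mk0 u hu0)
  have h2 := finHeckeValue_algebraMap_units L μ v (Units.mk0 t ht0)
  rw [Units.val_mk0] at h1 h2
  rw [← hu, ← ht, h1, h2, hv1, hv2, Units.val_one, inv_one, mul_one]

/-- **`D_{G∕H,v}((γ_H)_v) = 1` FOR ALMOST ALL `v`** under `χ_g(u) ≠ 0` (★ FILE A `eventually_finWeylRatio_rationalComponent_eq_one` with `hχ` for `hreg`: the GLOBAL
`χ_g(u) ∈ L^×` is a `w`-adic unit for almost all `w`). [cite: Rogawski1990, §4.9 p. 55; §14.6 p. 242] -/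
theorem eventually_finWeylRatio_rationalComponent_eq_one_of_eval_ne_zero
    (hχ : ((γH.1.val.val : Matrix (Fin 2) (Fin 2) L).charpoly).eval ((γH.2.val.val : Matrix (Fin 1) (Fin 1) L) 0 0) ≠ 0) :
    ∀ᶠ v : HeightOneSpectrum (𝓞 ↥(maximalRealSubfield L)) in cofinite, finWeylRatio L v (rationalComponent L γH v) = 1 := by
  filter_upwards [eventually_prod_placesOver_norm_coe_eq_one (↥(maximalRealSubfield L)) hχ] with v hv
  rw [finWeylRatio_rationalComponent]
  have hv' : (∏ w : UnitaryGroup.PlacesOver L v,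
      ‖algebraMap L (w.1.adicCompletion L) (((γH.1.val.val : Matrix (Fin 2) (Fin 2) L).charpoly).eval
        ((γH.2.val.val : Matrix (Fin 1) (Fin 1) L) 0 0))‖) = 1 := hv
  rw [hv', Real.sqrt_one]

/-- **«… and it is `+1` for almost all `v`»: `κ‴_v((γ_H)_v, γ̄_v) = 1` FOR ALMOST ALL `v`** for `H′` hermitian invertible, `γ_H ∈ H(L⁺)` with `χ_g(u) ≠ 0` and an
adelic `γ̄` matching `γ_H` at every finite place — ★ N3 `eventually_finKappaAt_rationalComponent_eq_one` with `hχ` for `hreg` (which it used only as `χ_g(u) ≠ 0`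
and as «`χ_{g_v}(u_v)` is a unit», §2): split `v`: `P_v ≠ 0`; non-split unramified `v` with `γ̄_v`, `H′`, `H′⁻¹`, `tr g`, `det g` integral and `χ_g(u)` a unit:
★ `finKappaAt_eq_one_of_integral_nonsplit`. [cite: Rogawski1990, §14.6 p. 242; §4.3 pp. 43–44] [cite: Kottwitz1986, §7] -/
theorem eventually_finKappaAt_rationalComponent_eq_one_of_eval_ne_zero (hherm : (H'.map (cmConjRingHom L))ᵀ = H') (hdet : IsUnit H'.det)
    (γ : (UnitaryGroup.cmDatum L 3 H').Adelic)
    (hχ : ((γH.1.val.val : Matrix (Fin 2) (Fin 2) L).charpoly).eval ((γH.2.val.val : Matrix (Fin 1) (Fin 1) L) 0 0) ≠ 0)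
    (hmatch : ∀ v, IsLocalNormPair L H' v (rationalComponent L γH v) ((UnitaryGroup.cmDatum L 3 H').toLocal v γ)) :
    ∀ᶠ v : HeightOneSpectrum (𝓞 ↥(maximalRealSubfield L)) in cofinite,
      finKappaAt L v H' (rationalComponent L γH v) ((UnitaryGroup.cmDatum L 3 H').toLocal v γ) = 1 := by
  -- the global elements
  set g₀ : Matrix (Fin 2) (Fin 2) L := (γH.1.val.val : Matrix (Fin 2) (Fin 2) L) with hg₀
  set u₀ : L := (γH.2.val.val : Matrix (Fin 1) (Fin 1) L) 0 0 with hu₀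
  have hc₀ : (g₀.charpoly).eval u₀ ≠ 0 := hχ
  -- (E1) unramified places
  have E1 : ∀ᶠ v : HeightOneSpectrum (𝓞 ↥(maximalRealSubfield L)) in cofinite, Algebra.IsUnramifiedIn (𝓞 L) v.asIdeal := by
    rw [Filter.eventually_cofinite]
    exact finite_setOf_not_isUnramifiedIn (↥(maximalRealSubfield L)) L
  -- (E2) the adelic `γ̄` is integral at almost every place
  have E2w : ∀ᶠ w : HeightOneSpectrum (𝓞 L) in cofinite,
      ∀ i j : Fin 3, ((((γ.val.val : Matrix (Fin 3) (Fin 3) (AdeleRing (𝓞 L) L)) i j).2 : FiniteAdeleRing (𝓞 L) L) w) ∈ w.adicCompletionIntegers L := by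
    simp only [Filter.eventually_all]
    exact fun i j => (((γ.val.val : Matrix (Fin 3) (Fin 3) (AdeleRing (𝓞 L) L)) i j).2).eventually
  have E2 := UnitaryGroup.eventually_forall_placesOver (F := ↥(maximalRealSubfield L)) L E2w
  -- (E3) `H′` and `H′⁻¹` are integral at almost every place
  have hint : ∀ e : L, ∀ᶠ w : HeightOneSpectrum (𝓞 L) in cofinite, Valued.v (algebraMap L (w.adicCompletion L) e) ≤ 1 := fun e => by
    rcases eq_or_ne e 0 with rfl | he
    · exact Filter.Eventually.of_forall fun w => by rw [map_zero, map_zero]; exact zero_le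
    · exact (UnitaryGroup.eventually_valued_algebraMap_eq_one L he).mono fun w hw => hw.le
  have E3w : ∀ᶠ w : HeightOneSpectrum (𝓞 L) in cofinite, ∀ i j : Fin 3,
      Valued.v (algebraMap L (w.adicCompletion L) (H' i j)) ≤ 1 ∧ Valued.v (algebraMap L (w.adicCompletion L) (H'⁻¹ i j)) ≤ 1 := by
    simp only [Filter.eventually_all, Filter.eventually_and]
    exact fun i j => ⟨hint (H' i j), hint (H'⁻¹ i j)⟩
  have E3 := UnitaryGroup.eventually_forall_placesOver (F := ↥(maximalRealSubfield L)) L E3w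
  -- (E4) `tr g`, `det g` integral and `χ_g(u)` a unit at almost every place
  have E4w : ∀ᶠ w : HeightOneSpectrum (𝓞 L) in cofinite,
      Valued.v (algebraMap L (w.adicCompletion L) g₀.trace) ≤ 1 ∧ Valued.v (algebraMap L (w.adicCompletion L) g₀.det) ≤ 1 ∧
        Valued.v (algebraMap L (w.adicCompletion L) ((g₀.charpoly).eval u₀)) = 1 :=
    (hint _).and ((hint _).and (UnitaryGroup.eventually_valued_algebraMap_eq_one L hc₀))
  have E4 := UnitaryGroup.eventually_forall_placesOver (F := ↥(maximalRealSubfield L)) L E4w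
  filter_upwards [E1, E2, E3, E4] with v h1 h2 h3 h4
  by_cases hv : Subsingleton (UnitaryGroup.PlacesOver L v)
  · obtain ⟨w⟩ := (inferInstance : Nonempty (UnitaryGroup.PlacesOver L v))
    have hg : ((rationalComponent L γH v).1.val.val : Matrix (Fin 2) (Fin 2) (UnitaryGroup.LocalRing L v)) =
        g₀.map (algebraMap L (UnitaryGroup.LocalRing L v)) := by
      unfold rationalComponent
      exact coe_coe_toLocal_toAdelic L v _ γH.1
    have htr : (g₀.map (algebraMap L (UnitaryGroup.LocalRing L v))).trace = algebraMap L (UnitaryGroup.LocalRing L v) g₀.trace := by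
      simp only [Matrix.trace, Matrix.diag_apply, Matrix.map_apply, map_sum]
    have hdt : (g₀.map (algebraMap L (UnitaryGroup.LocalRing L v))).det = algebraMap L (UnitaryGroup.LocalRing L v) g₀.det := by
      rw [RingHom.map_det, RingHom.mapMatrix_apply]
    refine finKappaAt_eq_one_of_integral_nonsplit L v H' _ _ hv w h1 hherm hdet (hmatch v)
      (fun i j => (h3 w i j).1) (fun i j => (h3 w i j).2) (fun i j => ?_) ?_ ?_ ?_
    · rw [← HeightOneSpectrum.mem_adicCompletionIntegers]
      exact h2 w i j
    · rw [hg, htr]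
      exact (h4 w).1
    · rw [hg, hdt]
      exact (h4 w).2.1
    · rw [finCharpolyTwo_rationalComponent, finGammaTwo_rationalComponent, Polynomial.eval_map, Polynomial.eval₂_hom]
      exact (h4 w).2.2
  · exact finKappaAt_of_not_subsingleton L v H' _
      (finEigenlineProjector_ne_zero_of_isUnit L v H' _ _ (hmatch v)
        (isUnit_eval_finCharpolyTwo_rationalComponent_of_eval_ne_zero L γH hχ v)) hv

/-- **`Δ‴_v((γ_H)_v, γ̄_v) = 1` FOR ALMOST ALL `v`** at a (G,H)-regular rational `γ_H` and an adelic `γ̄` matching it at every finite place — `Δ‴_v = τ_v · D_v · κ_v`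
on matching pairs (★ `finExplicitDelta_of_isLocalNormPair`) and the three factors are eventually `1`.  (The singular-pair instance of the a.e.-triviality that ★
`IsAlmostEverywhereTrivial` states for `G`-regular `γ_H` only.) [cite: Rogawski1990, §4.3 pp. 43–44; §14.6 p. 242] -/
theorem eventually_finExplicitDelta_rationalComponent_toLocal_eq_one_of_eval_ne_zero (hherm : (H'.map (cmConjRingHom L))ᵀ = H') (hdet : IsUnit H'.det)
    (μ : HeckeCharacter L) (γ : (UnitaryGroup.cmDatum L 3 H').Adelic)
    (hχ : ((γH.1.val.val : Matrix (Fin 2) (Fin 2) L).charpoly).eval ((γH.2.val.val : Matrix (Fin 1) (Fin 1) L) 0 0) ≠ 0)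
    (hmatch : ∀ v, IsLocalNormPair L H' v (rationalComponent L γH v) ((UnitaryGroup.cmDatum L 3 H').toLocal v γ)) :
    ∀ᶠ v : HeightOneSpectrum (𝓞 ↥(maximalRealSubfield L)) in cofinite,
      finExplicitDelta L v H' (rationalComponent L γH v) μ ((UnitaryGroup.cmDatum L 3 H').toLocal v γ) = 1 := by
  filter_upwards [eventually_finTau_rationalComponent_eq_one_of_eval_ne_zero L γH μ hχ,
    eventually_finWeylRatio_rationalComponent_eq_one_of_eval_ne_zero L γH hχ,
    eventually_finKappaAt_rationalComponent_eq_one_of_eval_ne_zero L H' γH hherm hdet γ hχ hmatch] with v h1 h2 h3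
  rw [finExplicitDelta_of_isLocalNormPair L v H' _ μ (hmatch v), h1, h2, h3]
  simp

end Rational

end Literature.NumberTheory.Rogawski1990

end
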